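import Mathlib
import HarnessLib
import Summits.Langlands.Langlands.Theses.CoreAdequacySplit
import Summits.Langlands.Langlands.Theorems.CoreAdequacySplitNoAdequateLayerLiftingAdequacyBridge
import Summits.Langlands.Langlands.Theorems.CoreAdequacySplitNoAdequateLayerLiftingKleinLayer
import Literature.NumberTheory.GaloisRepresentations.ResidualGaloisRep
import Literature.NumberTheory.GaloisRepresentations.ResidualGaloisRepOpenKernel
import Literature.NumberTheory.GaloisRepresentations.AdequateSubgroup
import Literature.NumberTheory.GaloisRepresentations.ExtendedAdequateSubgroup
import Literature.NumberTheory.GaloisRepresentations.ProjectiveType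
import Literature.NumberTheory.GaloisRepresentations.AbsGaloisGroup
import Literature.NumberTheory.GaloisRepresentations.AdequateOfCoprimeOrder
import Literature.NumberTheory.GaloisRepresentations.ResidualRepUnique
import Literature.NumberTheory.GaloisRepresentations.CalegariEvenFontaineMazurTwo
import Literature.RingTheory.Valuation.AlgClosedResidue
import Literature.NumberTheory.GaloisRepresentations.AdequacyDegreeTwoCharThree
import Literature.RepresentationTheory.Semisimple.BurnsideMatrixSpan

/-!
# RSL on the row `(n, ℓ) = (2, 3)`: the stub `stub_rung_rank2_ell3` of line `birth` of crux
`CoreAdequacySplit.NoAdequateLayerLifting`, from Barnet-Lamb–Gee–Geraghty's adequacy dichotomy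

Crux `Summit.Langlands.Langlands.Theses.CoreAdequacySplit.NoAdequateLayerLifting` (RSL, item
`stmt-Langlands-27954`), line `birth` (`Cruxes/NoAdequateLayerLifting/Lines/birth.lean`), stub
`stub_rung_rank2_ell3` — the row `(n, ℓ) = (2, 3)` of the residual table.  The stub carries RSL's
hypotheses verbatim; two of them are contradictory on this row, by finite group theory:

* `hc`: `ρ̄|Γ_{K(ζ₃)}` is absolutely irreducible — a reduction `τ : Γ_{K(ζ₃)} → GL₂(ℤ̄₃/𝔪)` of
  `ρ|Γ_{K(ζ₃)}` with `IsAbsIrreducible τ`; its image `I = τ(Γ_{K(ζ₃)})` is FINITE (the kernel of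
  a reduction is open, tree `FramedGaloisRep.isOpen_ker_of_isReductionOf`, and `Γ` is compact);
* `hA`: no such `τ` has Thorne-adequate image, and `hN`: no such `τ` has a Thorne-adequate,
  absolutely irreducible layer `J` with `P ≤ J ≤ I`, `P` the perfect core of `I`.

Barnet-Lamb–Gee–Geraghty, Math. Ann. 2013, App. A, Prop. A.2.1 (the tree's named fact
`Literature.NumberTheory.GaloisRepresentations.blgg2013_propA21_three`, case `ℓ = 3`): a finite irreducible `G ≤ GL₂(𝔽̄₃)` is adequate (in the
BLGGT clauses of their Def. A.1.1) unless its image in `PGL₂` is `PSL₂(𝔽₃) ≅ A₄`.  The BLGGT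
clauses give the tree's `Subgroup.IsThorneAdequate` (PROVED bridge
`isThorneAdequate_of_span_of_adRep`, file `CoreAdequacySplitNoAdequateLayerLiftingAdequacyBridge`),
contradicting `hA`; in the tetrahedral case (PROVED, `exists_klein_layer` of the helper file `…KleinLayer`) `I` is solvable —
so its perfect core is `⊥` — and the preimage `J ◁ I` of the Klein four-subgroup `V₄ ◁ A₄` acts
absolutely irreducibly (a common eigenvector of `J` would, with an `I`-translate, diagonalise `J`
with entries `(a, ±a)`, leaving at most two classes in `PGL₂` for the four elements of `V₄`) and
has projective image of order `4 ≠ 12`, so the fact applied to `J` makes `J` Thorne-adequate,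
contradicting `hN`.

Main results:
* the NAMED FACT `Literature.NumberTheory.GaloisRepresentations.blgg2013_propA21_three`
  (`Literature/NumberTheory/GaloisRepresentations/AdequacyDegreeTwoCharThree.lean`; statement
  only: BLGG 2013 App. A Prop. A.2.1 at `ℓ = 3`, Def. A.1.1 clauses in tree vocabulary);
* `finite_range_of_isReductionOf` — reductions of `ρ : Γ_K → GL_n(ℚ̄_ℓ)` have finite image;
* `isAbsIrreducible_of_isIrreducible` — over `k = k̄`, irreducible ⇒ absolutely irreducible
  (tree Burnside `span_eq_top_of_isIrreducible` + `span_eq_top_iff_forall_isIrreducible`);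
* (in the def-free helper file `CoreAdequacySplitNoAdequateLayerLiftingKleinLayer`, PROVED:
  `le_bot_of_commutator_eq_of_isSolvable`,
  `exists_klein_layer` — the Klein layer of a tetrahedral-type finite irreducible `I ≤ GL₂(k̄)`);
* `stub_rung_rank2_ell3_of_blgg2013` — **the registered stub signature VERBATIM, conditional on
  the named fact** (`(h : blgg2013_propA21_three) → <stub_rung_rank2_ell3>`).

Honest status: CONDITIONAL on one printed theorem (BLGG 2013 App. A Prop. A.2.1, case `ℓ = 3`,
whose proof needs `H¹(SL₂(𝔽_{3^a}), 𝔰𝔩₂) = 0`, `2.A₅`, and Dickson's identification — not in the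
tree); nothing here proves RSL off the row `(2, 3)`, and nothing here is an automorphy theorem.
-/

set_option linter.dupNamespace false

open scoped MatrixGroups
open Filter
open scoped Matrix

namespace Summit.Langlands.Langlands.Theorems.CoreAdequacy.NoAdequateLayer

open Literature.NumberTheory.GaloisRepresentations

/-! ### Finiteness of residual images; irreducible ⇒ absolutely irreducible over `k̄` -/

/-- **A reduction of a continuous `ρ : Γ_K → GL_n(ℚ̄_ℓ)` has finite image**: its kernel is open
(tree `FramedGaloisRep.isOpen_ker_of_isReductionOf`, Deligne–Serre 6.12) and `Γ_K` is compact,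
so the kernel has finite index (Mathlib `Subgroup.quotient_finite_of_isOpen`). [folklore] -/
theorem finite_range_of_isReductionOf {K : Type} [Field K] [NumberField K] {ℓ : ℕ} [Fact ℓ.Prime]
    {n : ℕ} {ρ : FramedGaloisRep K (PadicAlgCl ℓ) n} {k' : Type*} [Field k']
    {ι : padicAlgClResidueField ℓ →+* k'} {τ : Field.absoluteGaloisGroup K →* GL (Fin n) k'}
    (h : ρ.IsReductionOf ι τ) : Finite τ.range := by
  have hopen := FramedGaloisRep.isOpen_ker_of_isReductionOf h
  haveI : Finite (Field.absoluteGaloisGroup K ⧸ τ.ker) :=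
    Subgroup.quotient_finite_of_isOpen _ hopen
  exact Finite.of_equiv _ (QuotientGroup.quotientKerEquivRange τ).toEquiv

/-- **Over an algebraically closed field, irreducible ⇒ absolutely irreducible** (`n ≥ 1`):
Burnside (tree `span_eq_top_of_isIrreducible`) gives `k⟨σ(G)⟩ = M_n(k)`, which is absolute
irreducibility (tree `span_eq_top_iff_forall_isIrreducible`). [folklore] -/
theorem isAbsIrreducible_of_isIrreducible {k : Type*} [Field k] [IsAlgClosed k] {n : ℕ}
    {G : Type*} [Group G] (σ : G →* GL (Fin n) k) (hn : 0 < n)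
    (h : (glRepresentation σ).IsIrreducible) : IsAbsIrreducible σ := by
  have hspan := Literature.RepresentationTheory.Semisimple.span_eq_top_of_isIrreducible σ
    (hirr := h)
  exact (Literature.RepresentationTheory.Semisimple.span_eq_top_iff_forall_isIrreducible hn σ).1
    hspan

/-! ### The stub, conditional on the named fact -/

/-- **RSL on the row `(n, ℓ) = (2, 3)` — the registered stub `stub_rung_rank2_ell3` of line
`birth` of crux `CoreAdequacySplit.NoAdequateLayerLifting`, VERBATIM, conditional on
Barnet-Lamb–Gee–Geraghty 2013, App. A, Prop. A.2.1 (`blgg2013_propA21_three`).**  With `n = 2`,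
`ℓ = 3` the hypotheses `hc` (`ρ̄|Γ_{K(ζ₃)}` absolutely irreducible), `hA` (no Thorne-adequate
reduction) and `hN` (no Thorne-adequate absolutely irreducible layer above the perfect core) are
contradictory: the image `I` of the absolutely irreducible reduction `τ` is finite
(`finite_range_of_isReductionOf`); by the fact either `I` satisfies the BLGGT clauses — then it is
Thorne-adequate (`isThorneAdequate_of_span_of_adRep`, as `2 ≠ 0` in characteristic `3`),
contradicting `hA` — or `I` is of tetrahedral type, and then (`exists_klein_layer`) `I` is solvable
(perfect core `⊥`, `le_bot_of_commutator_eq_of_isSolvable`) and its Klein layer `J` is absolutely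
irreducible, not tetrahedral, hence BLGGT-adequate by the fact and Thorne-adequate by the bridge,
contradicting `hN` with `P = ⊥`.  No automorphy theorem is used or proved.
[cite: BarnetlambGeeGeraghty2013MathAnn, App. A, Prop. A.2.1] -/
theorem stub_rung_rank2_ell3_of_blgg2013
    (hBLGG : Literature.NumberTheory.GaloisRepresentations.blgg2013_propA21_three) :
    ∀ (K : Type) [Field K] [NumberField K] (n : ℕ) (hcpt : Literature.NumberTheory.Automorphic.isCompact_glFiniteIntegralLevel n K), 0 < n → (∀ m : ℕ, m < n → ∀ (K : Type) [Field K] [NumberField K] (hcpt : Literature.NumberTheory.Automorphic.isCompact_glFiniteIntegralLevel m K), 0 < m → ∀ (ℓ : ℕ) [Fact ℓ.Prime] (ι : PadicAlgCl ℓ ≃+* ℂ) (ρ : Literature.NumberTheory.GaloisRepresentations.FramedGaloisRep K (PadicAlgCl ℓ) m), ρ.toGaloisRep.IsIrreducible → ((∀ᶠ v : IsDedekindDomain.HeightOneSpectrum (NumberField.RingOfIntegers K) in cofinite, ρ.IsUnramifiedAt v) ∧ ∀ (v : IsDedekindDomain.HeightOneSpectrum (NumberField.RingOfIntegers K)) (hv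 : ((ℓ : ℕ) : NumberField.RingOfIntegers K) ∈ v.asIdeal), (Literature.NumberTheory.PAdicHodge.fontainePstAdicCompletion v ℓ hv).IsDeRhamFramed (ρ.toLocal v)) → (∃ (π : Literature.NumberTheory.Automorphic.CuspidalAutomorphicRepData m K hcpt) (ρ' : Literature.NumberTheory.GaloisRepresentations.FramedGaloisRep K (PadicAlgCl ℓ) m), π.1.IsLAlgebraic ∧ ρ'.toGaloisRep.IsIrreducible ∧ (∀ᶠ v : IsDedekindDomain.HeightOneSpectrum (NumberField.RingOfIntegers K) in cofinite, SatakeFrobCompatibleAt ι π.1 ρ' v) ∧ ∀ᶠ v : IsDedekindDomain.HeightOneSpectrum (NumberField.RingOfIntegers K) in cofinite, ∃ P P' : Polynomial (Valued.v : Valuation (PadicAlgCl ℓ) NNReal).valuationSubring, ρ.HasFrobCharpolyAt v (P.map (Valued.v : Valuation (PadicAlgCl ℓ) NNReal).valuationSubring.subtype) ∧ ρ'.HasFrobCharpolyAt v (P'.map (Valued.v : Valuation (PadicAlgCl ℓ) NNReal).valuationSubring.subtype) ∧ P.map (IsLocalRing.residue (Valued.v : Valuation (PadicAlgCl ℓ)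 NNReal).valuationSubring) = P'.map (IsLocalRing.residue (Valued.v : Valuation (PadicAlgCl ℓ) NNReal).valuationSubring)) → ∃ π : Literature.NumberTheory.Automorphic.CuspidalAutomorphicRepData m K hcpt, π.1.IsLAlgebraic ∧ ∀ᶠ v : IsDedekindDomain.HeightOneSpectrum (NumberField.RingOfIntegers K) in cofinite, SatakeFrobCompatibleAt ι π.1 ρ v) → ∀ (ℓ : ℕ) [Fact ℓ.Prime] (ι : PadicAlgCl ℓ ≃+* ℂ) (ρ : Literature.NumberTheory.GaloisRepresentations.FramedGaloisRep K (PadicAlgCl ℓ) n), ℓ < 2 * (n + 1) → n = 2 → ℓ = 3 → (ρ.restrictField (CyclotomicField ℓ K)).IsResiduallyAbsIrreducible → ¬ (∃ τ : Field.absoluteGaloisGroup (CyclotomicField ℓ K) →* Matrix.GeneralLinearGroup (Fin n) (Literature.NumberTheory.GaloisRepresentations.padicAlgClResidueField ℓ), (ρ.restrictField (CyclotomicField ℓ K)).IsReductionOf (RingHom.id (Literature.NumberTheory.GaloisRepresentations.padicAlgClResidueField ℓ)) τ ∧ Literature.NumberTheory.GaloisRepresentations.IsAbsIrreducible τ ∧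 Literature.NumberTheory.GaloisRepresentations.Subgroup.IsThorneAdequate τ.range) → ¬ (∃ τ : Field.absoluteGaloisGroup (CyclotomicField ℓ K) →* Matrix.GeneralLinearGroup (Fin n) (Literature.NumberTheory.GaloisRepresentations.padicAlgClResidueField ℓ), (ρ.restrictField (CyclotomicField ℓ K)).IsReductionOf (RingHom.id (Literature.NumberTheory.GaloisRepresentations.padicAlgClResidueField ℓ)) τ ∧ Literature.NumberTheory.GaloisRepresentations.IsAbsIrreducible τ ∧ ∃ P J : Subgroup (Matrix.GeneralLinearGroup (Fin n) (Literature.NumberTheory.GaloisRepresentations.padicAlgClResidueField ℓ)), (P ≤ τ.range ∧ ⁅P, P⁆ = P ∧ ∀ Q : Subgroup (Matrix.GeneralLinearGroup (Fin n) (Literature.NumberTheory.GaloisRepresentations.padicAlgClResidueField ℓ)), Q ≤ τ.range → ⁅Q, Q⁆ = Q → Q ≤ P) ∧ P ≤ J ∧ J ≤ τ.range ∧ Literature.NumberTheory.GaloisRepresentations.IsAbsIrreducible J.subtype ∧ Literature.NumberTheory.GaloisRepresentations.Subgroup.IsThorneAdequate J) → ¬ (∃ (E : Type) (_ : Field E)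 (_ : NumberField E) (_ : Algebra K E), IsGalois K E ∧ IsSolvable (E ≃ₐ[K] E) ∧ ∃ (m : ℕ) (ϑ : Literature.NumberTheory.GaloisRepresentations.FramedGaloisRep E (PadicAlgCl ℓ) m), m < n ∧ 0 < m ∧ ϑ.toGaloisRep.IsIrreducible ∧ ((∀ᶠ v : IsDedekindDomain.HeightOneSpectrum (NumberField.RingOfIntegers E) in cofinite, ϑ.IsUnramifiedAt v) ∧ ∀ (v : IsDedekindDomain.HeightOneSpectrum (NumberField.RingOfIntegers E)) (hv : ((ℓ : ℕ) : NumberField.RingOfIntegers E) ∈ v.asIdeal), (Literature.NumberTheory.PAdicHodge.fontainePstAdicCompletion v ℓ hv).IsDeRhamFramed (ϑ.toLocal v)) ∧ (∃ (mc : ℕ) (θc : Literature.NumberTheory.GaloisRepresentations.FramedGaloisRep E (PadicAlgCl ℓ) mc), ∀ g : Field.absoluteGaloisGroup E, Literature.NumberTheory.GaloisRepresentations.FramedRep.trace (ρ.restrictField E) g = Literature.NumberTheory.GaloisRepresentations.FramedRep.trace ϑ g + Literature.NumberTheory.GaloisRepresentations.FramedRep.trace θc g)) → ¬ ((∃ (S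 : Finset (IsDedekindDomain.HeightOneSpectrum (NumberField.RingOfIntegers K))) (Q : IsDedekindDomain.HeightOneSpectrum (NumberField.RingOfIntegers K) → Polynomial ℂ) (I : Finset ℤ) (L : Set ℕ) (r : ∀ (ℓ' : ℕ) [Fact ℓ'.Prime], (PadicAlgCl ℓ' ≃+* ℂ) → Literature.NumberTheory.GaloisRepresentations.FramedGaloisRep K (PadicAlgCl ℓ') n), ((∃ E : Subfield ℂ, FiniteDimensional ℚ E ∧ ∀ v : IsDedekindDomain.HeightOneSpectrum (NumberField.RingOfIntegers K), v ∉ S → ∀ i : ℕ, (Q v).coeff i ∈ E) ∧ Literature.NumberTheory.LFunctions.HasDirichletDensity L 1 ∧ ∀ (ℓ' : ℕ) [Fact ℓ'.Prime], ℓ' ∈ L → ∀ ι' : PadicAlgCl ℓ' ≃+* ℂ, (r ℓ' ι').toGaloisRep.IsIrreducible ∧ (∀ᶠ v : IsDedekindDomain.HeightOneSpectrum (NumberField.RingOfIntegers K) in cofinite, (r ℓ' ι').IsUnramifiedAt v) ∧ (∀ v : IsDedekindDomain.HeightOneSpectrum (NumberField.RingOfIntegers K), v ∉ S → ((ℓ'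 : ℕ) : NumberField.RingOfIntegers K) ∉ v.asIdeal → (r ℓ' ι').IsUnramifiedAt v ∧ (r ℓ' ι').HasFrobCharpolyAt v ((Q v).map (ι'.symm : ℂ ≃+* PadicAlgCl ℓ').toRingHom)) ∧ ∀ (v : IsDedekindDomain.HeightOneSpectrum (NumberField.RingOfIntegers K)) (hv : ((ℓ' : ℕ) : NumberField.RingOfIntegers K) ∈ v.asIdeal), (Literature.NumberTheory.PAdicHodge.fontainePstAdicCompletion v ℓ' hv).IsDeRhamFramed ((r ℓ' ι').toLocal v) ∧ (v ∉ S → (Literature.NumberTheory.PAdicHodge.fontainePstAdicCompletion v ℓ' hv).IsCrystallineFramed ((r ℓ' ι').toLocal v) ∧ letI := (Literature.NumberTheory.PAdicHodge.fontainePstAdicCompletion v ℓ' hv).algebra; ∀ τ : v.adicCompletion K →ₐ[ℚ_[ℓ']] PadicAlgCl ℓ', ∀ h ∈ (r ℓ' ι').labelledHodgeTateWeightsAt v (Literature.NumberTheory.PAdicHodge.fontainePstAdicCompletion v ℓ' hv).algebra (Literature.NumberTheory.PAdicHodge.fontainePstAdicCompletion v ℓ' hv).𝔅 τ.toRingHom,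 h ∈ I)) ∧ ∀ v : IsDedekindDomain.HeightOneSpectrum (NumberField.RingOfIntegers K), v ∉ S → ((ℓ : ℕ) : NumberField.RingOfIntegers K) ∉ v.asIdeal → ρ.IsUnramifiedAt v ∧ ρ.HasFrobCharpolyAt v ((Q v).map (ι.symm : ℂ ≃+* PadicAlgCl ℓ).toRingHom)) ∨ ∃ (N : Type) (_ : Field N) (_ : NumberField N) (_ : Algebra K N) (M : Type) (_ : Field M) (_ : NumberField M) (_ : Algebra K M) (_ : Algebra M N) (_ : IsScalarTower K M N), IsGalois K N ∧ IsSolvable (N ≃ₐ[K] N) ∧ (ρ.restrictField M).toGaloisRep.IsIrreducible ∧ ∃ (S : Finset (IsDedekindDomain.HeightOneSpectrum (NumberField.RingOfIntegers M))) (Q : IsDedekindDomain.HeightOneSpectrum (NumberField.RingOfIntegers M) → Polynomial ℂ) (I : Finset ℤ) (L : Set ℕ) (r : ∀ (ℓ' : ℕ) [Fact ℓ'.Prime], (PadicAlgCl ℓ' ≃+* ℂ) → Literature.NumberTheory.GaloisRepresentations.FramedGaloisRep M (PadicAlgCl ℓ') n), ((∃ E : Subfield ℂ, FiniteDimensional ℚ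 E ∧ ∀ v : IsDedekindDomain.HeightOneSpectrum (NumberField.RingOfIntegers M), v ∉ S → ∀ i : ℕ, (Q v).coeff i ∈ E) ∧ Literature.NumberTheory.LFunctions.HasDirichletDensity L 1 ∧ ∀ (ℓ' : ℕ) [Fact ℓ'.Prime], ℓ' ∈ L → ∀ ι' : PadicAlgCl ℓ' ≃+* ℂ, (r ℓ' ι').toGaloisRep.IsIrreducible ∧ (∀ᶠ v : IsDedekindDomain.HeightOneSpectrum (NumberField.RingOfIntegers M) in cofinite, (r ℓ' ι').IsUnramifiedAt v) ∧ (∀ v : IsDedekindDomain.HeightOneSpectrum (NumberField.RingOfIntegers M), v ∉ S → ((ℓ' : ℕ) : NumberField.RingOfIntegers M) ∉ v.asIdeal → (r ℓ' ι').IsUnramifiedAt v ∧ (r ℓ' ι').HasFrobCharpolyAt v ((Q v).map (ι'.symm : ℂ ≃+* PadicAlgCl ℓ').toRingHom)) ∧ ∀ (v : IsDedekindDomain.HeightOneSpectrum (NumberField.RingOfIntegers M)) (hv : ((ℓ' : ℕ) : NumberField.RingOfIntegers M) ∈ v.asIdeal), (Literature.NumberTheory.PAdicHodge.fontainePstAdicCompletion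 v ℓ' hv).IsDeRhamFramed ((r ℓ' ι').toLocal v) ∧ (v ∉ S → (Literature.NumberTheory.PAdicHodge.fontainePstAdicCompletion v ℓ' hv).IsCrystallineFramed ((r ℓ' ι').toLocal v) ∧ letI := (Literature.NumberTheory.PAdicHodge.fontainePstAdicCompletion v ℓ' hv).algebra; ∀ τ : v.adicCompletion M →ₐ[ℚ_[ℓ']] PadicAlgCl ℓ', ∀ h ∈ (r ℓ' ι').labelledHodgeTateWeightsAt v (Literature.NumberTheory.PAdicHodge.fontainePstAdicCompletion v ℓ' hv).algebra (Literature.NumberTheory.PAdicHodge.fontainePstAdicCompletion v ℓ' hv).𝔅 τ.toRingHom, h ∈ I)) ∧ ∀ v : IsDedekindDomain.HeightOneSpectrum (NumberField.RingOfIntegers M), v ∉ S → ((ℓ : ℕ) : NumberField.RingOfIntegers M) ∉ v.asIdeal → (ρ.restrictField M).IsUnramifiedAt v ∧ (ρ.restrictField M).HasFrobCharpolyAt v ((Q v).map (ι.symm : ℂ ≃+* PadicAlgCl ℓ).toRingHom)) → ρ.toGaloisRep.IsIrreducible → ((∀ᶠ v : IsDedekindDomain.HeightOneSpectrum (NumberField.RingOfIntegers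 K) in cofinite, ρ.IsUnramifiedAt v) ∧ ∀ (v : IsDedekindDomain.HeightOneSpectrum (NumberField.RingOfIntegers K)) (hv : ((ℓ : ℕ) : NumberField.RingOfIntegers K) ∈ v.asIdeal), (Literature.NumberTheory.PAdicHodge.fontainePstAdicCompletion v ℓ hv).IsDeRhamFramed (ρ.toLocal v)) → (∃ (π : Literature.NumberTheory.Automorphic.CuspidalAutomorphicRepData n K hcpt) (ρ' : Literature.NumberTheory.GaloisRepresentations.FramedGaloisRep K (PadicAlgCl ℓ) n), π.1.IsLAlgebraic ∧ ρ'.toGaloisRep.IsIrreducible ∧ (∀ᶠ v : IsDedekindDomain.HeightOneSpectrum (NumberField.RingOfIntegers K) in cofinite, SatakeFrobCompatibleAt ι π.1 ρ' v) ∧ ∀ᶠ v : IsDedekindDomain.HeightOneSpectrum (NumberField.RingOfIntegers K) in cofinite, ∃ P P' : Polynomial (Valued.v : Valuation (PadicAlgCl ℓ) NNReal).valuationSubring, ρ.HasFrobCharpolyAt v (P.map (Valued.v : Valuation (PadicAlgCl ℓ) NNReal).valuationSubring.subtype) ∧ ρ'.HasFrobCharpolyAt v (P'.map (Valued.v : Valuation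 (PadicAlgCl ℓ) NNReal).valuationSubring.subtype) ∧ P.map (IsLocalRing.residue (Valued.v : Valuation (PadicAlgCl ℓ) NNReal).valuationSubring) = P'.map (IsLocalRing.residue (Valued.v : Valuation (PadicAlgCl ℓ) NNReal).valuationSubring)) → ∃ π : Literature.NumberTheory.Automorphic.CuspidalAutomorphicRepData n K hcpt, π.1.IsLAlgebraic ∧ ∀ᶠ v : IsDedekindDomain.HeightOneSpectrum (NumberField.RingOfIntegers K) in cofinite, SatakeFrobCompatibleAt ι π.1 ρ v := by
  intro K _ _ n hcpt hn ih ℓ _ ι ρ hlt hn2 hl3 hc hA hN hsr hsm hirrρ hgeom hres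
  exfalso
  subst hn2
  subst hl3
  obtain ⟨τ, hred, hirr⟩ := hc
  haveI : Finite τ.range := finite_range_of_isReductionOf hred
  haveI : IsAlgClosed (padicAlgClResidueField 3) :=
    Literature.RingTheory.Valuation.isAlgClosed_residueField (padicAlgClIntegers 3)
  haveI : CharP (padicAlgClResidueField 3) 3 := charP_padicAlgClResidueField 3
  have h2n : ((2 : ℕ) : padicAlgClResidueField 3) ≠ 0 := by
    rw [Ne, CharP.cast_eq_zero_iff (padicAlgClResidueField 3) 3]
    decide
  have hirrI : (glRepresentation τ.range.subtype).IsIrreducible :=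
    hirr.range_subtype.isIrreducible_glRepresentation
  rcases hBLGG (padicAlgClResidueField 3) τ.range hirrI with hT | ⟨h1, h3, h4⟩
  · obtain ⟨hsolv, J, hJI, hJabs, hJirr, hJT⟩ := exists_klein_layer τ.range hirrI hT
    haveI : Finite J := Finite.of_injective _ (Subgroup.inclusion_injective hJI)
    rcases hBLGG (padicAlgClResidueField 3) J hJirr with hT' | ⟨j1, j3, j4⟩
    · exact hJT hT'
    · haveI := hsolv
      exact hN ⟨τ, hred, hirr, ⊥, J, ⟨bot_le, Subgroup.commutator_bot_left ⊥,
        fun Q hQ hQQ => le_bot_of_commutator_eq_of_isSolvable τ.range Q hQ hQQ⟩, bot_le, hJI,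
        hJabs, isThorneAdequate_of_span_of_adRep J h2n j1 j3 j4⟩
  · exact hA ⟨τ, hred, hirr, isThorneAdequate_of_span_of_adRep τ.range h2n h1 h3 h4⟩

end Summit.Langlands.Langlands.Theorems.CoreAdequacy.NoAdequateLayer
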